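import Mathlib
import Summits.Ventures.PercRepro2.SwAllLMarkDefs

/-!
# THE MARK WITH NEIGHBOURS `p`, `l` AND `h`, I: the transports (blind cell PercRepro2, night-4 g30,
2026-08-28; proofs/NIGHT4-G30.md §8)

`IsLHMarkAt`: ONE edge `e₀ = x–p`, every other edge at `x` joins `x` to `l` or to `h` (any
multiplicities), `x ≠ p, l, h`, `p ≠ l, h`.  On the side `Q_x` every edge `x–l` is red and every
edge `x–h` is blue; the red cluster of `l` is read as for the L-mark (`x` attached to `l` carries
`p`'s red cluster when `e₀` is red: `IsLHMarkAt.cluster_eq_of_allRed`), and in the BLUE colouring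
`x` is attached to `h` and to `p` only, so the H-mark's transport applies to any root whose
cluster avoids `h` (`cluster_transport_closed`, the H-mark transport with closed edges allowed).
Hence `IsLHMarkAt.mem_tgt_iff`: `Q_x = {every x–l red, every x–h blue, h ∉ H′_l, (e₀ red →
p ∉ C′_R(h)), (e₀ blue → p ∉ C′_B(l))}`, and `IsLHMarkAt.redEdges_eq`.
-/

namespace Summit.Ventures.PercRepro2

namespace LocRows

open Hull

variable {V : Type*} {E : Type*}

open scoped Classical

/-- `x` is an LH-MARK vertex relative to `p`: one edge `e₀ = x–p`, every other edge at `x` joins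
`x` to `l` or to `h`. -/
structure IsLHMarkAt (ends : E → Sym2 V) (x p l h : V) (e₀ : E) : Prop where
  xp : x ≠ p
  xl : x ≠ l
  xh : x ≠ h
  pl : p ≠ l
  ph : p ≠ h
  ends₀ : ends e₀ = s(x, p)
  edges : ∀ e, x ∈ ends e → e = e₀ ∨ ends e = s(x, l) ∨ ends e = s(x, h)

variable {ends : E → Sym2 V} {x p l h : V} {e₀ : E}

/-- **Cluster transport with closed edges**: for a root `v ≠ x` whose cluster avoids `h`, in a
colouring in which every open edge at `x` joins `x` to `p` or to `h`, the clusters of the graph and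
of the isolated graph agree away from `x`, and `x` is in the cluster iff some open edge `x–p` has
`p` in it. -/
theorem cluster_transport_closed {ω : Config E}
    (hopen : ∀ e, x ∈ ends e → ω e = true → ends e = s(x, p) ∨ ends e = s(x, h))
    {v : V} (hv : v ≠ x) (hh : h ∉ cluster ends ω v) :
    (∀ w, w ≠ x → (w ∈ cluster ends ω v ↔ w ∈ cluster (isolate ends x) ω v)) ∧
    (x ∈ cluster ends ω v ↔
      ∃ e, ends e = s(x, p) ∧ ω e = true ∧ p ∈ cluster (isolate ends x) ω v) := by
  have hS : cluster ends ω v ⊆ {y | y ∈ cluster ends ω v ∧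
      ((y ≠ x ∧ y ∈ cluster (isolate ends x) ω v) ∨
        (y = x ∧ ∃ e, ends e = s(x, p) ∧ ω e = true ∧ p ∈ cluster (isolate ends x) ω v))} := by
    intro y hy
    refine mem_of_conn_of_closed (ends := ends) (ω := ω) ?_
      ⟨mem_cluster_self _ _ _, Or.inl ⟨hv, mem_cluster_self _ _ _⟩⟩ hy
    rintro a ⟨ha, ha'⟩ b hab
    obtain ⟨hne, e, he, hends⟩ := openGraph_adj.1 hab
    have hb : b ∈ cluster ends ω v := mem_cluster_of_edge ha he hends
    refine ⟨hb, ?_⟩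
    by_cases hbx : b = x
    · rw [hbx] at hends hne
      have hax : a ≠ x := hne
      have hxe : x ∈ ends e := by rw [hends]; exact Sym2.mem_mk_right _ _
      rcases hopen e hxe he with h1 | h1
      · rw [hends, Sym2.eq_iff] at h1
        rcases h1 with ⟨h2, -⟩ | ⟨h2, -⟩
        · exact absurd h2 hax
        · refine Or.inr ⟨hbx, e, by rw [hends, h2, Sym2.eq_swap], he, ?_⟩
          rcases ha' with ⟨-, ha''⟩ | ⟨hax', -⟩
          · rw [← h2]; exact ha''
          · exact absurd hax' hax
      · rw [hends, Sym2.eq_iff] at h1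
        rcases h1 with ⟨h2, -⟩ | ⟨h2, -⟩
        · exact absurd h2 hax
        · exact absurd (h2 ▸ ha) hh
    · refine Or.inl ⟨hbx, ?_⟩
      rcases ha' with ⟨hax, ha''⟩ | ⟨hax, e', he', hred', hp'⟩
      · exact mem_cluster_of_edge ha'' he (isolate_eq_of_ends_eq hax hbx hends)
      · rw [hax] at hends
        have hxe : x ∈ ends e := by rw [hends]; exact Sym2.mem_mk_left _ _
        rcases hopen e hxe he with h1 | h1
        · rw [hends, Sym2.eq_iff] at h1
          rcases h1 with ⟨-, h2⟩ | ⟨-, h2⟩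
          · rw [h2]; exact hp'
          · exact absurd h2 hbx
        · rw [hends, Sym2.eq_iff] at h1
          rcases h1 with ⟨-, h2⟩ | ⟨-, h2⟩
          · exact absurd (h2 ▸ hb) hh
          · exact absurd h2 hbx
  constructor
  · intro w hw
    constructor
    · intro hw'
      rcases (hS hw').2 with ⟨-, h'⟩ | ⟨h', -⟩
      · exact h'
      · exact absurd h' hw
    · exact fun hw' => cluster_isolate_subset ω v hw'
  · constructor
    · intro hx
      rcases (hS hx).2 with ⟨h', -⟩ | ⟨-, h'⟩
      · exact absurd rfl h'
      · exact h'
    · rintro ⟨e, he, hred, hp⟩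
      exact mem_cluster_of_edge (cluster_isolate_subset ω v hp) hred (ends_swap he)

variable (hm : IsLHMarkAt ends x p l h e₀)
include hm

/-- The other end of an edge at `x` is `p` (for `e₀`), `l` or `h`. -/
lemma IsLHMarkAt.other_eq {e : E} {y : V} (he : ends e = s(x, y)) :
    (e = e₀ ∧ y = p) ∨ y = l ∨ y = h := by
  have hxe : x ∈ ends e := by rw [he]; exact Sym2.mem_mk_left _ _
  rcases hm.edges e hxe with rfl | h' | h'
  · rw [hm.ends₀, Sym2.eq_iff] at he
    rcases he with ⟨-, h1⟩ | ⟨-, h2⟩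
    · exact Or.inl ⟨rfl, h1.symm⟩
    · exact absurd h2.symm hm.xp
  · rw [h', Sym2.eq_iff] at he
    rcases he with ⟨-, h1⟩ | ⟨-, h2⟩
    · exact Or.inr (Or.inl h1.symm)
    · exact absurd h2.symm hm.xl
  · rw [h', Sym2.eq_iff] at he
    rcases he with ⟨-, h1⟩ | ⟨-, h2⟩
    · exact Or.inr (Or.inr h1.symm)
    · exact absurd h2.symm hm.xh

/-- **The red cluster of `l` when every edge `x–l` is red and every edge `x–h` is closed**: the
cluster of the isolated graph, `x`, and the red cluster of `p` of the isolated graph when `e₀` is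
open. -/
theorem IsLHMarkAt.cluster_eq_of_allRed {ζ : Config E}
    (hd : ∀ d, ends d = s(x, l) → ζ d = true) (hg : ∀ g, ends g = s(x, h) → ζ g = false)
    (hsome : ∃ d, ends d = s(x, l)) :
    cluster ends ζ l =
      cluster (isolate ends x) ζ l ∪ {x} ∪
        {y | ζ e₀ = true ∧ y ∈ cluster (isolate ends x) ζ p} := by
  obtain ⟨d₀, hd₀⟩ := hsome
  have hxR : x ∈ cluster ends ζ l :=
    mem_cluster_of_edge (mem_cluster_self _ _ _) (hd d₀ hd₀) (ends_swap hd₀)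
  apply Set.Subset.antisymm
  · intro w hw
    refine mem_of_conn_of_closed (ends := ends) (ω := ζ) ?_
      (Or.inl (Or.inl (mem_cluster_self _ _ _))) hw
    rintro a ha b hab
    obtain ⟨hne, e, he, hends⟩ := openGraph_adj.1 hab
    by_cases hbx : b = x
    · exact Or.inl (Or.inr hbx)
    by_cases hax : a = x
    · rw [hax] at hends
      rcases hm.other_eq hends with ⟨rfl, rfl⟩ | rfl | rfl
      · exact Or.inr ⟨he, mem_cluster_self _ _ _⟩
      · exact Or.inl (Or.inl (mem_cluster_self _ _ _))
      · exfalso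
        rw [hg e hends] at he
        exact Bool.noConfusion he
    · have hends' := isolate_eq_of_ends_eq hax hbx hends
      rcases ha with (ha | ha) | ⟨he₀, ha⟩
      · exact Or.inl (Or.inl (mem_cluster_of_edge ha he hends'))
      · exact absurd ha hax
      · exact Or.inr ⟨he₀, mem_cluster_of_edge ha he hends'⟩
  · rintro w ((hw | hw) | ⟨he₀, hw⟩)
    · exact cluster_isolate_subset ζ l hw
    · rw [Set.mem_singleton_iff] at hw
      rw [hw]; exact hxR
    · have hp : p ∈ cluster ends ζ l := mem_cluster_of_edge hxR he₀ hm.ends₀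
      exact conn_trans hp (cluster_isolate_subset ζ p hw)

/-- In a colouring with every edge `x–l` closed, every open edge at `x` joins `x` to `p` or `h`. -/
lemma IsLHMarkAt.open_to_p_or_h {ω : Config E} (hd : ∀ d, ends d = s(x, l) → ω d = false) :
    ∀ e, x ∈ ends e → ω e = true → ends e = s(x, p) ∨ ends e = s(x, h) := by
  intro e hxe he
  rcases hm.edges e hxe with rfl | h' | h'
  · exact Or.inl hm.ends₀
  · rw [hd e h'] at he
    exact Bool.noConfusion he
  · exact Or.inr h'

section Side

variable [Fintype E] [DecidableEq E]

/-- **The side of the LH-mark** in terms of the isolated graph. -/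
theorem IsLHMarkAt.mem_tgt_iff (hsome : ∃ d, ends d = s(x, l)) {ζ : Config E} :
    ζ ∈ tgtU ends l h {S : Set V | x ∈ S} ↔
      (∀ d, ends d = s(x, l) → ζ d = true) ∧ (∀ g, ends g = s(x, h) → ζ g = false) ∧
        h ∉ hull (isolate ends x) ζ l ∧
        (ζ e₀ = true → p ∉ cluster (isolate ends x) ζ h) ∧
        (ζ e₀ = false → p ∉ cluster (isolate ends x) (blue ζ) l) := by
  rw [LocRows.mem_tgt_iff]
  have hlx : l ≠ x := hm.xl.symm
  constructor
  · rintro ⟨hh, hxR, hxB⟩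
    have hhR : h ∉ cluster ends ζ l := fun h' => hh (Or.inl h')
    have hhB : h ∉ cluster ends (blue ζ) l := fun h' => hh (Or.inr h')
    have hd : ∀ d, ends d = s(x, l) → ζ d = true := by
      intro d hd'
      cases hζd : ζ d with
      | true => rfl
      | false =>
        exfalso
        have hb : blue ζ d = true := by rw [blue_eq_true_iff]; exact hζd
        exact hxB (mem_cluster_of_edge (mem_cluster_self _ _ _) hb (ends_swap hd'))
    have hg : ∀ g, ends g = s(x, h) → ζ g = false := by
      intro g hg'
      cases hζg : ζ g with
      | false => rfl
      | true => exact absurd (mem_cluster_of_edge hxR hζg hg') hhR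
    have hdb : ∀ d, ends d = s(x, l) → blue ζ d = false := by
      intro d hd'
      rw [blue_apply, hd d hd']; rfl
    have hR := hm.cluster_eq_of_allRed hd hg hsome
    have hB := cluster_transport_closed (h := h) (p := p) (hm.open_to_p_or_h hdb) hlx hhB
    refine ⟨hd, hg, ?_, ?_, ?_⟩
    · rintro (h1 | h1)
      · exact hhR (by rw [hR]; exact Or.inl (Or.inl h1))
      · exact hhB ((hB.1 h hm.xh.symm).2 h1)
    · intro he₀ hp
      apply hhR
      rw [hR]
      exact Or.inr ⟨he₀, conn_symm hp⟩
    · intro he₀ hp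
      apply hxB
      exact hB.2.2 ⟨e₀, hm.ends₀, by rw [blue_eq_true_iff]; exact he₀, hp⟩
  · rintro ⟨hd, hg, hh', hpR, hpB⟩
    have hdb : ∀ d, ends d = s(x, l) → blue ζ d = false := by
      intro d hd'
      rw [blue_apply, hd d hd']; rfl
    have hR := hm.cluster_eq_of_allRed hd hg hsome
    have hhR : h ∉ cluster ends ζ l := by
      rw [hR]
      rintro ((h1 | h1) | ⟨he₀, h1⟩)
      · exact hh' (Or.inl h1)
      · exact hm.xh.symm h1
      · exact hpR he₀ (conn_symm h1)
    -- the blue cluster of `l` avoids `h`: `x` is a blue leaf-or-bridge at `p` and `h`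
    have hhB : h ∉ cluster ends (blue ζ) l := by
      intro h1
      -- the blue path from `l` to `h` enters `x` only through `e₀` from `p ∈ C′_B(l)`
      have key : h ∈ {y | (y ≠ x ∧ y ∈ cluster (isolate ends x) (blue ζ) l) ∨
          (y = x ∧ blue ζ e₀ = true ∧ p ∈ cluster (isolate ends x) (blue ζ) l) ∨
          (y ≠ x ∧ blue ζ e₀ = true ∧ p ∈ cluster (isolate ends x) (blue ζ) l ∧
            y ∈ cluster (isolate ends x) (blue ζ) h)} := by
        refine mem_of_conn_of_closed (ends := ends) (ω := blue ζ) ?_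
          (Or.inl ⟨hlx, mem_cluster_self _ _ _⟩) h1
        rintro a ha b hab
        obtain ⟨hne, e, he, hends⟩ := openGraph_adj.1 hab
        by_cases hbx : b = x
        · rw [hbx] at hends hne
          have hax : a ≠ x := hne
          rcases hm.other_eq (ends_swap hends) with ⟨rfl, rfl⟩ | rfl | rfl
          · rcases ha with ⟨-, ha'⟩ | ⟨hax', -⟩ | ⟨-, -, hp', -⟩
            · exact Or.inr (Or.inl ⟨hbx, he, ha'⟩)
            · exact absurd hax' hax
            · exact Or.inr (Or.inl ⟨hbx, he, hp'⟩)
          · exfalso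
            rw [hdb e (ends_swap hends)] at he
            exact Bool.noConfusion he
          · -- `h ∈ C′_B(l)` contradicts `hh'`; `h` on the `p`-side: then `x` joins `h`
            rcases ha with ⟨-, ha'⟩ | ⟨hax', -⟩ | ⟨-, he₀, hp', hhh⟩
            · exact absurd (Or.inr ha') hh'
            · exact absurd hax' hax
            · exact Or.inr (Or.inl ⟨hbx, he₀, hp'⟩)
        · by_cases hax : a = x
          · rw [hax] at hends
            rcases ha with ⟨hax', -⟩ | ⟨-, he₀, hp'⟩ | ⟨hax', -⟩
            · exact absurd hax hax'
            · rcases hm.other_eq hends with ⟨-, rfl⟩ | rfl | rfl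
              · exact Or.inl ⟨hbx, hp'⟩
              · exfalso
                rw [hdb e hends] at he
                exact Bool.noConfusion he
              · exact Or.inr (Or.inr ⟨hbx, he₀, hp', mem_cluster_self _ _ _⟩)
            · exact absurd hax hax'
          · have hends' := isolate_eq_of_ends_eq hax hbx hends
            rcases ha with ⟨-, ha'⟩ | ⟨hax', -⟩ | ⟨-, he₀, hp', hah⟩
            · exact Or.inl ⟨hbx, mem_cluster_of_edge ha' he hends'⟩
            · exact absurd hax' hax
            · exact Or.inr (Or.inr ⟨hbx, he₀, hp', mem_cluster_of_edge hah he hends'⟩)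
      rcases key with ⟨-, h2⟩ | ⟨h2, -⟩ | ⟨-, he₀, hp', -⟩
      · exact hh' (Or.inr h2)
      · exact hm.xh h2.symm
      · rw [blue_eq_true_iff] at he₀
        exact hpB he₀ hp'
    refine ⟨fun h1 => h1.elim hhR hhB, ?_, ?_⟩
    · rw [hR]; exact Or.inl (Or.inr rfl)
    · intro hx
      have hB := cluster_transport_closed (h := h) (p := p) (hm.open_to_p_or_h hdb) hlx hhB
      obtain ⟨e', he', hblue, hp'⟩ := hB.2.1 hx
      rcases hm.other_eq he' with ⟨rfl, -⟩ | h2 | h2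
      · rw [blue_eq_true_iff] at hblue
        exact hpB hblue hp'
      · exact hm.pl h2
      · exact hm.ph h2

end Side

end LocRows

end Summit.Ventures.PercRepro2
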